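import Summits.Ventures.PercRepro.S2TriangleThree
import Summits.Ventures.PercRepro.S2UniqueCircuit

/-!
# PercRepro — S2: THE HITTING LEVER AT CORANK `7` (p7, gen 14; sub-claim S2; the spread case of `(14, 7)`)

At corank `7` a top `6`-set `B` (`ρ(B) = 5`, `E ∖ B` spanning) has a complement of `p + 1` points and rank `p` — nullity `1`, one circuit — so it
meets the union of any two distinct circuits (**`top_six_inter_union_nonempty`**, g9's `S2.isCircuit_eq_of_disjoint_of_spanning_compl`); a top
`5`-set has a complement of nullity `2`, and three distinct triangles have a union of nullity `≥ 3` (each has a point outside the other two, and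
those three points lie in the closure of the rest: **`eRk_union_three_triangles_add_three_le`**), so a top `5`-set meets `T₁ ∪ T₂ ∪ T₃`
(**`top_five_inter_union_three_nonempty`**). Axioms: standard.
-/

open scoped Matroid

namespace PercRepro

namespace S2

open Set

variable {α : Type}

/-- **At corank `7` every top `6`-set meets the union of any two distinct circuits.** -/
theorem top_six_inter_union_nonempty (M : Matroid α) [M.Finite] {p : ℕ} (hR : M.eRank = (p : ℕ∞))
    (hn : M.E.ncard = p + 7) {C₁ C₂ : Set α} (h₁ : M.IsCircuit C₁) (h₂ : M.IsCircuit C₂) (hne : C₁ ≠ C₂) :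
    ∀ B ⊆ M.E, B.ncard = 6 → M.eRk (M.E \ B) = M.eRank → (B ∩ (C₁ ∪ C₂)).Nonempty := by
  intro B hBE hB6 hBs
  by_contra hcon
  rw [Set.not_nonempty_iff_eq_empty] at hcon
  have hd : M.E.encard = M.eRank + (((6 : ℕ) : ℕ∞) + 1) := by
    rw [hR, ← M.ground_finite.cast_ncard_eq, hn]
    push_cast
    ring
  have hBk : B.encard = ((6 : ℕ) : ℕ∞) := by
    rw [← (M.ground_finite.subset hBE).cast_ncard_eq, hB6]
  have hdis₁ : Disjoint C₁ B := by
    rw [Set.disjoint_left]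
    intro y hy hyB
    have : y ∈ B ∩ (C₁ ∪ C₂) := ⟨hyB, Or.inl hy⟩
    rw [hcon] at this
    exact this
  have hdis₂ : Disjoint C₂ B := by
    rw [Set.disjoint_left]
    intro y hy hyB
    have : y ∈ B ∩ (C₁ ∪ C₂) := ⟨hyB, Or.inr hy⟩
    rw [hcon] at this
    exact this
  exact hne (isCircuit_eq_of_disjoint_of_spanning_compl M hBE hd hBk hBs h₁ hdis₁ h₂ hdis₂)

/-- **Three distinct triangles have a union of nullity `≥ 3`**: `ρ(T₁ ∪ T₂ ∪ T₃) + 3 ≤ |T₁ ∪ T₂ ∪ T₃|`. -/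
theorem eRk_union_three_triangles_add_three_le (M : Matroid α) [M.Finite]
    (hC1 : ∀ L ⊆ M.E, M.eRk L = 2 → L.ncard ≤ 3)
    {T₁ T₂ T₃ : Set α} (hT₁ : M.IsCircuit T₁) (hT₁3 : T₁.ncard = 3) (hT₂ : M.IsCircuit T₂) (hT₂3 : T₂.ncard = 3)
    (hT₃ : M.IsCircuit T₃) (hT₃3 : T₃.ncard = 3) (h12 : T₁ ≠ T₂) (h13 : T₁ ≠ T₃) (h23 : T₂ ≠ T₃) :
    M.eRk (T₁ ∪ T₂ ∪ T₃) + 3 ≤ (T₁ ∪ T₂ ∪ T₃).encard := by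
  classical
  obtain ⟨x₃, hx₃, hx₃'⟩ := ThmN.exists_mem_triangle_notMem_union M hC1 hT₁ hT₁3 hT₂ hT₂3 hT₃ hT₃3 h13 h23
  obtain ⟨x₂, hx₂, hx₂'⟩ := ThmN.exists_mem_triangle_notMem_union M hC1 hT₁ hT₁3 hT₃ hT₃3 hT₂ hT₂3 h12 (Ne.symm h23)
  obtain ⟨x₁, hx₁, hx₁'⟩ := ThmN.exists_mem_triangle_notMem_union M hC1 hT₂ hT₂3 hT₃ hT₃3 hT₁ hT₁3 (Ne.symm h12) (Ne.symm h13)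
  set U := T₁ ∪ T₂ ∪ T₃ with hU
  have hUE : U ⊆ M.E := Set.union_subset (Set.union_subset hT₁.subset_ground hT₂.subset_ground) hT₃.subset_ground
  have hUfin : U.Finite := M.ground_finite.subset hUE
  set D := U \ {x₁, x₂, x₃} with hD
  -- the private points are distinct and in `U`
  have hx₁U : x₁ ∈ U := Or.inl (Or.inl hx₁)
  have hx₂U : x₂ ∈ U := Or.inl (Or.inr hx₂)
  have hx₃U : x₃ ∈ U := Or.inr hx₃
  have h12' : x₁ ≠ x₂ := fun h => hx₁' (h ▸ Or.inl hx₂)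
  have h13' : x₁ ≠ x₃ := fun h => hx₁' (h ▸ Or.inr hx₃)
  have h23' : x₂ ≠ x₃ := fun h => hx₂' (h ▸ Or.inr hx₃)
  -- each `Tᵢ ∖ {xᵢ} ⊆ D`
  have hT₁D : T₁ \ {x₁} ⊆ D := by
    rintro y ⟨hy, hyx⟩
    refine ⟨Or.inl (Or.inl hy), ?_⟩
    rintro (rfl | rfl | rfl)
    · exact hyx rfl
    · exact hx₂' (Or.inl hy)
    · exact hx₃' (Or.inl hy)
  have hT₂D : T₂ \ {x₂} ⊆ D := by
    rintro y ⟨hy, hyx⟩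
    refine ⟨Or.inl (Or.inr hy), ?_⟩
    rintro (rfl | rfl | rfl)
    · exact hx₁' (Or.inl hy)
    · exact hyx rfl
    · exact hx₃' (Or.inr hy)
  have hT₃D : T₃ \ {x₃} ⊆ D := by
    rintro y ⟨hy, hyx⟩
    refine ⟨Or.inr hy, ?_⟩
    rintro (rfl | rfl | rfl)
    · exact hx₁' (Or.inr hy)
    · exact hx₂' (Or.inr hy)
    · exact hyx rfl
  -- `U ⊆ cl D`
  have hUcl : U ⊆ M.closure D := by
    intro y hy
    by_cases hyD : y ∈ D
    · exact M.subset_closure D (sdiff_subset.trans hUE) hyD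
    · have hyx : y ∈ ({x₁, x₂, x₃} : Set α) := by
        by_contra h
        exact hyD ⟨hy, h⟩
      rcases hyx with rfl | rfl | rfl
      · exact M.closure_subset_closure hT₁D (hT₁.mem_closure_sdiff_singleton_of_mem hx₁)
      · exact M.closure_subset_closure hT₂D (hT₂.mem_closure_sdiff_singleton_of_mem hx₂)
      · exact M.closure_subset_closure hT₃D (hT₃.mem_closure_sdiff_singleton_of_mem hx₃)
  have hr : M.eRk U ≤ M.eRk D := by
    calc M.eRk U ≤ M.eRk (M.closure D) := M.eRk_mono hUcl
      _ = M.eRk D := M.eRk_closure_eq D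
  have hDcard : D.encard + 3 = U.encard := by
    have hsub : ({x₁, x₂, x₃} : Set α) ⊆ U := by
      rintro y (rfl | rfl | rfl)
      · exact hx₁U
      · exact hx₂U
      · exact hx₃U
    have h := Set.encard_sdiff_add_encard_of_subset hsub
    rw [Set.encard_insert_of_notMem (by
        rintro (rfl | rfl)
        · exact h12' rfl
        · exact h13' rfl), Set.encard_pair h23'] at h
    rw [← h]
    norm_num
    ring
  calc M.eRk U + 3 ≤ M.eRk D + 3 := by gcongr
    _ ≤ D.encard + 3 := by gcongr; exact M.eRk_le_encard D
    _ = U.encard := hDcard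

/-- **At corank `7` every top `5`-set meets the union of three distinct triangles** (its complement has nullity `2`). -/
theorem top_five_inter_union_three_nonempty (M : Matroid α) [M.Finite] {p : ℕ} (hR : M.eRank = (p : ℕ∞))
    (hn : M.E.ncard = p + 7) (hC1 : ∀ L ⊆ M.E, M.eRk L = 2 → L.ncard ≤ 3)
    {T₁ T₂ T₃ : Set α} (hT₁ : M.IsCircuit T₁) (hT₁3 : T₁.ncard = 3) (hT₂ : M.IsCircuit T₂) (hT₂3 : T₂.ncard = 3)
    (hT₃ : M.IsCircuit T₃) (hT₃3 : T₃.ncard = 3) (h12 : T₁ ≠ T₂) (h13 : T₁ ≠ T₃) (h23 : T₂ ≠ T₃) :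
    ∀ B ⊆ M.E, B.ncard = 5 → M.eRk (M.E \ B) = M.eRank → (B ∩ (T₁ ∪ T₂ ∪ T₃)).Nonempty := by
  intro B hBE hB5 hBs
  by_contra hcon
  rw [Set.not_nonempty_iff_eq_empty] at hcon
  set U := T₁ ∪ T₂ ∪ T₃ with hU
  have hUE : U ⊆ M.E := Set.union_subset (Set.union_subset hT₁.subset_ground hT₂.subset_ground) hT₃.subset_ground
  have hsub : U ⊆ M.E \ B := by
    intro y hy
    refine ⟨hUE hy, fun hyB => ?_⟩
    have : y ∈ B ∩ U := ⟨hyB, hy⟩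
    rw [hcon] at this
    exact this
  have h3 := eRk_union_three_triangles_add_three_le M hC1 hT₁ hT₁3 hT₂ hT₂3 hT₃ hT₃3 h12 h13 h23
  have hBfin : B.Finite := M.ground_finite.subset hBE
  have hEBfin : (M.E \ B).Finite := M.ground_finite.sdiff
  -- `|E ∖ B| = p + 2` and `ρ(E ∖ B) = p`
  have hcard : (M.E \ B).ncard = p + 2 := by
    rw [Set.ncard_sdiff hBE hBfin, hn, hB5]
    omega
  -- nullity is monotone: `|E ∖ B| ≥ ρ(E ∖ B) + 3`
  have hsplit : M.E \ B = U ∪ ((M.E \ B) \ U) := (Set.union_sdiff_cancel hsub).symm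
  have hr : M.eRk (M.E \ B) ≤ M.eRk U + ((M.E \ B) \ U).encard := by
    calc M.eRk (M.E \ B) = M.eRk (U ∪ ((M.E \ B) \ U)) := by rw [← hsplit]
      _ ≤ M.eRk U + ((M.E \ B) \ U).encard := M.eRk_union_le_eRk_add_encard _ _
  have hc : ((M.E \ B) \ U).encard + U.encard = (M.E \ B).encard := Set.encard_sdiff_add_encard_of_subset hsub
  have hfinU : U.encard ≠ ⊤ := (M.ground_finite.subset hUE).encard_lt_top.ne
  have hfinR : ((M.E \ B) \ U).encard ≠ ⊤ := hEBfin.sdiff.encard_lt_top.ne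
  have key : M.eRk (M.E \ B) + 3 ≤ (M.E \ B).encard := by
    calc M.eRk (M.E \ B) + 3 ≤ (M.eRk U + ((M.E \ B) \ U).encard) + 3 := by gcongr
      _ = (M.eRk U + 3) + ((M.E \ B) \ U).encard := by ring
      _ ≤ U.encard + ((M.E \ B) \ U).encard := by gcongr
      _ = (M.E \ B).encard := by rw [← hc]; ring
  rw [hBs, hR, ← hEBfin.cast_ncard_eq, hcard] at key
  have : (p : ℕ) + 3 ≤ p + 2 := by exact_mod_cast key
  omega

end S2

end PercRepro
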